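import Summits.CriticalPhenomena.SAWScalingLimit.Theorems.SAWTotalPositivityCriticalBubbleBoundJoinDefs
import Summits.CriticalPhenomena.SAWScalingLimit.Theorems.SAWTotalPositivityCriticalBubbleBoundDockingPolygonAPI
import Summits.CriticalPhenomena.SAWScalingLimit.Theorems.SAWTotalPositivityCriticalBubbleBoundDockingUnflip
import Summits.CriticalPhenomena.SAWScalingLimit.Theorems.SAWTotalPositivityCriticalBubbleBoundDockingEntropyZero
import Literature.Probability.RandomPlanarGeometry.SAWReflect

/-!
# The vertical flip on lex-rooted polygon classes (line `docking-census-joining`, stub `lexRooted_transport_vrefl`)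

Crux `stmt-CriticalPhenomena-7117`
(`Summit.CriticalPhenomena.SAWScalingLimit.Theses.SAWTotalPositivity.CriticalBubbleBound`), line
`docking-census-joining` (JOIN-MASS programme, lead c6), registered stub `lexRooted_transport_vrefl`;
objects `lexRooted`, `width`, `height`, `ymin`, `ymax`, `tipRow`, `esRow` of
`…Theorems.SAWTotalPositivityCriticalBubbleBoundJoinDefs` and `verts`, `pedges`, `rootEdge` of
`…Theorems.SAWTotalPositivityCriticalBubbleBoundDockingDefs`.

**Statement.** For `n ≥ 3` there is a map `F` on vertex functions, injective on `lexRooted n`, with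
`F χ ∈ lexRooted n`, `width (F χ) = width χ`, `height (F χ) = height χ`,
`ymin (F χ) + ymax (F χ) = ymin χ + ymax χ` and `tipRow (F χ) = ymin χ + ymax χ - esRow χ` — the second
half of Hammond's Lemma 4.9 ("left polygons are at least a quarter of all polygons": the vertical flip
exchanges the two halves `tip above / below the middle row`).

**Proof.** For `χ ∈ lexRooted n` let `t` be the TOP-LEFT vertex of `P(χ) = pedges n χ` (highest row,
then leftmost). The affine map `g : x ↦ (x₀ - t₀, t₁ - x₁)` (vertical flip followed by the translation
taking `t` to `0`; `Zd.reflAt 1 0 (x - t)`) is an injective graph endomorphism of `ℤ²`, so the image `C`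
of `P(χ)` is a polygon with `n + 1` edges; the corner lemma gives `{t, t + e₀} ∈ P(χ)`, whence
`rootEdge = {0, e₀} ∈ C`, and opening `C` at the root (`Docking.exists_sawFun_of_isPolygon`) gives
`F χ := χ' ∈ Zd.sawFun 2 n e₀` with `pedges n χ' = C`. All vertices of `C` are lexicographically `≥ 0` by
the choice of `t`, so `χ'` is lex-rooted. The vertex set of `χ'` is `g (verts n χ)`, so `xmax, xmin`
shift by `-t₀`, `ymax (F χ) = t₁ - ymin χ`, `ymin (F χ) = t₁ - ymax χ`, the rightmost column goes to the
rightmost column and its lowest row `esRow` to the highest row `tipRow (F χ) = t₁ - esRow χ`; with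
`t₁ = ymax χ` and `ymin χ = 0` (lex-rooted) these are the four identities. Injectivity: if `F χ₁ = F χ₂`
then `g₁ (verts χ₁) = g₂ (verts χ₂)`; evaluating at the two roots `0` (lex-minimal in `verts χᵢ`) forces
`t₁ = t₂`, `g₁ = g₂`, hence `P(χ₁) = P(χ₂)` (`Sym2.map g` is injective) and `χ₁ = χ₂`
(`Docking.eq_of_pedges_shift_eq`).

Sources: A. Hammond, *An upper bound on the number of self-avoiding polygons via joining*, Ann. Probab.
46 (2018), Lemma 4.9; N. Madras, G. Slade, *The Self-Avoiding Walk* (1993), Definition 3.2.1–3.2.2.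
Elementary combinatorics ([folklore]).
-/

noncomputable section

open Literature.Probability.LatticeModels
open Literature.Probability.RandomPlanarGeometry Literature.Probability.RandomPlanarGeometry.SAW
open scoped BigOperators
open Summit.CriticalPhenomena.SAWScalingLimit.Theorems.CriticalBubbleBound.Negative (e₀)
open Summit.CriticalPhenomena.SAWScalingLimit.Theorems.CriticalBubbleBound.Docking

namespace Summit.CriticalPhenomena.SAWScalingLimit.Theorems.CriticalBubbleBound.Join

/-! ## Re-rooted vertical flips `x ↦ (x₀ - t₀, t₁ - x₁)`, described by their coordinates -/

/-- A map with coordinates `x ↦ (x₀ - t₀, t₁ - x₁)` is injective. [folklore] -/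
theorem injective_of_flipCoord {t : Site 2} {g : Site 2 → Site 2}
    (hg : ∀ x, g x 0 = x 0 - t 0 ∧ g x 1 = t 1 - x 1) : Function.Injective g := by
  intro x y h
  have h0 := congrFun h 0
  have h1 := congrFun h 1
  rw [(hg x).1, (hg y).1] at h0
  rw [(hg x).2, (hg y).2] at h1
  ext j
  fin_cases j
  · show x 0 = y 0
    omega
  · show x 1 = y 1
    omega

/-- Comparing two flipped pictures of vertex sets: if `g₁ (S₁) = g₂ (S₂)` for flips anchored at `t₁`,
`t₂`, with `0 ∈ S₁` and `S₂` lexicographically nonnegative, then `(−t₁ 1, t₁ 0) ≤ (−t₂ 1, t₂ 0)`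
lexicographically. [folklore] -/
theorem flip_root_le {S₁ S₂ : Finset (Site 2)} {t₁ t₂ : Site 2} {g₁ g₂ : Site 2 → Site 2}
    (hg₁ : ∀ x, g₁ x 0 = x 0 - t₁ 0 ∧ g₁ x 1 = t₁ 1 - x 1)
    (hg₂ : ∀ x, g₂ x 0 = x 0 - t₂ 0 ∧ g₂ x 1 = t₂ 1 - x 1) (h0 : (0 : Site 2) ∈ S₁)
    (hlex : ∀ y ∈ S₂, LexPos y) (h : S₁.image g₁ = S₂.image g₂) :
    t₁ 1 < t₂ 1 ∨ (t₁ 1 = t₂ 1 ∧ t₁ 0 ≤ t₂ 0) := by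
  have hm : g₁ 0 ∈ S₂.image g₂ := h ▸ Finset.mem_image_of_mem _ h0
  obtain ⟨y, hy, hye⟩ := Finset.mem_image.1 hm
  have c0 := congrFun hye 0
  have c1 := congrFun hye 1
  rw [(hg₂ y).1, (hg₁ 0).1, Pi.zero_apply] at c0
  rw [(hg₂ y).2, (hg₁ 0).2, Pi.zero_apply] at c1
  rcases hlex y hy with h1 | ⟨h1, h2⟩
  · exact Or.inl (by omega)
  · exact Or.inr ⟨by omega, by omega⟩

/-! ## Images of polygons under injective graph endomorphisms -/

/-- The image of a polygon under an injective graph endomorphism of `ℤ²` is a polygon (map the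
cycle). [folklore] -/
theorem isPolygon_image_of_hom {f : zdGraph 2 →g zdGraph 2} (hf : Function.Injective f)
    {E : Finset (Sym2 (Site 2))} (hE : IsPolygon (zdGraph 2) E) :
    IsPolygon (zdGraph 2) (E.image (Sym2.map f)) := by
  classical
  obtain ⟨u, w, hw, rfl⟩ := hE
  refine ⟨_, w.map f, hw.map hf, ?_⟩
  rw [SimpleGraph.Walk.edges_map]
  ext e
  simp only [List.mem_toFinset, List.mem_map, Finset.mem_image]

/-- The vertex set follows the edge set: if `pedges n χ'` is the image of `pedges n χ` under
`Sym2.map g`, then `verts n χ'` is the image of `verts n χ` under `g`. [folklore] -/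
theorem verts_eq_of_pedges_eq_image {n : ℕ} {χ χ' : ℕ → Site 2} {g : Site 2 → Site 2}
    (h : pedges n χ' = (pedges n χ).image (Sym2.map g)) :
    verts n χ' = (verts n χ).image g := by
  ext x
  rw [← exists_mem_pedges_iff, h, Finset.mem_image]
  constructor
  · rintro ⟨e, he, hx⟩
    obtain ⟨e', he', rfl⟩ := Finset.mem_image.1 he
    obtain ⟨y, hy, rfl⟩ := Sym2.mem_map.1 hx
    exact ⟨y, exists_mem_pedges_iff.1 ⟨e', he', hy⟩, rfl⟩
  · rintro ⟨y, hy, rfl⟩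
    obtain ⟨e', he', hy'⟩ := exists_mem_pedges_iff.2 hy
    exact ⟨Sym2.map g e', Finset.mem_image_of_mem _ he', Sym2.mem_map.2 ⟨y, hy', rfl⟩⟩

/-! ## Corners at the level of vertex sets -/

/-- Coordinate bounds of a vertex. [folklore] -/
theorem bounds_of_mem_verts {n : ℕ} {χ : ℕ → Site 2} {v : Site 2} (hv : v ∈ verts n χ) :
    xmin n χ ≤ v 0 ∧ v 0 ≤ xmax n χ ∧ ymin n χ ≤ v 1 ∧ v 1 ≤ ymax n χ := by
  obtain ⟨i, hi, rfl⟩ := Finset.mem_image.1 hv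
  have hi' := Nat.lt_succ_iff.1 (Finset.mem_range.1 hi)
  exact ⟨xmin_le_apply χ hi', apply_le_xmax χ hi', ymin_le_apply χ hi', apply_le_ymax χ hi'⟩

/-- The four extremal coordinates are attained by vertices. [folklore] -/
theorem exists_verts_extremes (n : ℕ) (χ : ℕ → Site 2) :
    (∃ v ∈ verts n χ, v 0 = xmax n χ) ∧ (∃ v ∈ verts n χ, v 0 = xmin n χ) ∧
      (∃ v ∈ verts n χ, v 1 = ymax n χ) ∧ (∃ v ∈ verts n χ, v 1 = ymin n χ) := by
  refine ⟨?_, ?_, ?_, ?_⟩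
  · obtain ⟨i, hi, h⟩ := exists_apply_eq_xmax n χ
    exact ⟨χ i, apply_mem_verts χ hi, h⟩
  · obtain ⟨i, hi, h⟩ := Finset.mem_image.1 (Finset.min'_mem (xs n χ) (xs_nonempty n χ))
    exact ⟨χ i, apply_mem_verts χ (Nat.lt_succ_iff.1 (Finset.mem_range.1 hi)), h⟩
  · obtain ⟨i, hi, h⟩ := exists_apply_eq_ymax n χ
    exact ⟨χ i, apply_mem_verts χ hi, h⟩
  · obtain ⟨i, hi, h⟩ := exists_apply_eq_ymin n χ
    exact ⟨χ i, apply_mem_verts χ hi, h⟩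

/-- `xmax` is characterised as the attained upper bound of the abscissae. [folklore] -/
theorem xmax_eq_of_verts {n : ℕ} {χ : ℕ → Site 2} {M : ℤ} (h1 : ∀ v ∈ verts n χ, v 0 ≤ M)
    (h2 : ∃ v ∈ verts n χ, v 0 = M) : xmax n χ = M := by
  obtain ⟨v, hv, hvM⟩ := (exists_verts_extremes n χ).1
  obtain ⟨w, hw, hwM⟩ := h2
  exact le_antisymm (hvM ▸ h1 v hv) (hwM ▸ (bounds_of_mem_verts hw).2.1)

/-- `xmin` is characterised as the attained lower bound of the abscissae. [folklore] -/
theorem xmin_eq_of_verts {n : ℕ} {χ : ℕ → Site 2} {M : ℤ} (h1 : ∀ v ∈ verts n χ, M ≤ v 0)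
    (h2 : ∃ v ∈ verts n χ, v 0 = M) : xmin n χ = M := by
  obtain ⟨v, hv, hvM⟩ := (exists_verts_extremes n χ).2.1
  obtain ⟨w, hw, hwM⟩ := h2
  exact le_antisymm (hwM ▸ (bounds_of_mem_verts hw).1) (hvM ▸ h1 v hv)

/-- `ymax` is characterised as the attained upper bound of the ordinates. [folklore] -/
theorem ymax_eq_of_verts {n : ℕ} {χ : ℕ → Site 2} {M : ℤ} (h1 : ∀ v ∈ verts n χ, v 1 ≤ M)
    (h2 : ∃ v ∈ verts n χ, v 1 = M) : ymax n χ = M := by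
  obtain ⟨v, hv, hvM⟩ := (exists_verts_extremes n χ).2.2.1
  obtain ⟨w, hw, hwM⟩ := h2
  exact le_antisymm (hvM ▸ h1 v hv) (hwM ▸ (bounds_of_mem_verts hw).2.2.2)

/-- `ymin` is characterised as the attained lower bound of the ordinates. [folklore] -/
theorem ymin_eq_of_verts {n : ℕ} {χ : ℕ → Site 2} {M : ℤ} (h1 : ∀ v ∈ verts n χ, M ≤ v 1)
    (h2 : ∃ v ∈ verts n χ, v 1 = M) : ymin n χ = M := by
  obtain ⟨v, hv, hvM⟩ := (exists_verts_extremes n χ).2.2.2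
  obtain ⟨w, hw, hwM⟩ := h2
  exact le_antisymm (hwM ▸ (bounds_of_mem_verts hw).2.2.1) (hvM ▸ h1 v hv)

/-- `tipRow` is characterised as the attained upper bound of the rows of the rightmost column.
[folklore] -/
theorem tipRow_eq_of_rightCol {n : ℕ} {χ : ℕ → Site 2} {M : ℤ} (h1 : ∀ v ∈ rightCol n χ, v 1 ≤ M)
    (h2 : ∃ v ∈ rightCol n χ, v 1 = M) : tipRow n χ = M := by
  obtain ⟨v, hv, hvM⟩ := exists_eq_tipRow n χ
  obtain ⟨w, hw, hwM⟩ := h2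
  exact le_antisymm (hvM ▸ h1 v hv) (hwM ▸ le_tipRow hw)

/-! ## The reflected representative -/

/-- **The reflected lex-rooted representative.** For `χ ∈ Zd.sawFun 2 n e₀`, `n ≥ 3`, with top-left
vertex `t`, the image of `pedges n χ` under the re-rooted vertical flip `g : x ↦ (x₀ - t₀, t₁ - x₁)` is
`pedges n χ'` for a LEX-ROOTED `χ'`. [cite: MadrasSlade1993, Definition 3.2.2] -/
theorem exists_vrefl {n : ℕ} (hn : 3 ≤ n) {χ : ℕ → Site 2} (hχ : χ ∈ Zd.sawFun 2 n e₀) :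
    ∃ (χ' : ℕ → Site 2) (t : Site 2) (g : Site 2 → Site 2), χ' ∈ lexRooted n ∧ t ∈ verts n χ ∧
      (∀ x ∈ verts n χ, x 1 ≤ t 1) ∧ (∀ x, g x 0 = x 0 - t 0 ∧ g x 1 = t 1 - x 1) ∧
      pedges n χ' = (pedges n χ).image (Sym2.map g) := by
  classical
  have hn2 : 2 ≤ n := le_trans (by norm_num) hn
  -- the top-left vertex and its east edge
  obtain ⟨t, ht, htmax, htleft⟩ :=
    exists_max_left (S := verts n χ) ⟨χ 0, apply_mem_verts χ n.zero_le⟩ fun x => x 1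
  have hte : s(t, t + e₀) ∈ pedges n χ := by
    refine mem_pedges_of_corner hχ hn2 ht (fun h => ?_) (Or.inl fun h => ?_)
    · have h1 := htleft _ h (by simp [e₀_e₁_apply.2.1])
      simp only [Pi.sub_apply, e₀_e₁_apply.1] at h1
      omega
    · have h1 := htmax _ h
      simp only [Pi.add_apply, e₀_e₁_apply.2.2.2] at h1
      omega
  -- the re-rooted vertical flip
  obtain ⟨g, hg, hgadj⟩ : ∃ g : Site 2 → Site 2, (∀ x, g x 0 = x 0 - t 0 ∧ g x 1 = t 1 - x 1) ∧
      ∀ x y, (zdGraph 2).Adj x y → (zdGraph 2).Adj (g x) (g y) := by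
    refine ⟨fun x => Zd.reflAt 1 0 (x - t), fun x => ⟨?_, ?_⟩, fun x y h => ?_⟩
    · show Zd.reflAt 1 0 (x - t) 0 = x 0 - t 0
      rw [Zd.reflAt_apply_of_ne (show (0 : Fin 2) ≠ 1 by decide), Pi.sub_apply]
    · show Zd.reflAt 1 0 (x - t) 1 = t 1 - x 1
      rw [Zd.reflAt_apply_same, Pi.sub_apply]
      ring
    · exact (Zd.zdGraph_adj_reflAt 1 0 _ _).2 ((Zd.zdGraph_adj_sub_right x y t).2 h)
  have hg0 : g t = 0 := by
    ext j
    fin_cases j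
    · show g t 0 = 0
      rw [(hg t).1, sub_self]
    · show g t 1 = 0
      rw [(hg t).2, sub_self]
  have hge : g (t + e₀) = e₀ := by
    ext j
    fin_cases j
    · show g (t + e₀) 0 = e₀ 0
      rw [(hg _).1, Pi.add_apply, e₀_e₁_apply.1]
      ring
    · show g (t + e₀) 1 = e₀ 1
      rw [(hg _).2, Pi.add_apply, e₀_e₁_apply.2.1]
      ring
  -- the image polygon, opened at the root
  have hCpoly : IsPolygon (zdGraph 2) ((pedges n χ).image (Sym2.map g)) :=
    isPolygon_image_of_hom (f := ⟨g, fun h => hgadj _ _ h⟩) (injective_of_flipCoord hg)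
      (isPolygon_pedges n χ hχ hn)
  have hCcard : ((pedges n χ).image (Sym2.map g)).card = n + 1 := by
    rw [Finset.card_image_of_injective _ (Sym2.map.injective (injective_of_flipCoord hg)),
      card_pedges hχ hn2]
  have hroot : rootEdge ∈ (pedges n χ).image (Sym2.map g) :=
    Finset.mem_image.2 ⟨_, hte, by rw [Sym2.map_mk, hg0, hge]; rfl⟩
  obtain ⟨χ', hχ', hχ'e⟩ := exists_sawFun_of_isPolygon hCpoly hroot hCcard
  refine ⟨χ', t, g, mem_lexRooted.2 ⟨hχ', fun m hm => ?_⟩, ht, htmax, hg, hχ'e⟩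
  -- every vertex of the image is lexicographically nonnegative
  have hv : χ' m ∈ (verts n χ).image g := by
    rw [← verts_eq_of_pedges_eq_image hχ'e]
    exact apply_mem_verts χ' hm
  obtain ⟨x, hx, hxe⟩ := Finset.mem_image.1 hv
  rw [← hxe]
  unfold LexPos
  rw [(hg x).1, (hg x).2]
  rcases lt_or_eq_of_le (htmax x hx) with h1 | h1
  · exact Or.inl (by omega)
  · have h2 := htleft x hx h1
    exact Or.inr ⟨by omega, by omega⟩

/-- **Stub `lexRooted_transport_vrefl`** (Hammond's Lemma 4.9, the vertical flip). For `n ≥ 3` the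
map `χ ↦ χ'` of `exists_vrefl` (vertical flip of `P(χ)`, re-rooted at the lowest-then-leftmost vertex
of the image) is injective on `lexRooted n`, stays in `lexRooted n`, preserves width, height and
`ymin + ymax`, and sends the lowest rightmost row to the highest:
`tipRow (F χ) = ymin χ + ymax χ - esRow χ`. [cite: Hammond2015SAPJoining, Lemma 4.9] -/
theorem lexRooted_transport_vrefl : ∀ n : ℕ, 3 ≤ n → ∃ F : (ℕ → Site 2) → (ℕ → Site 2), Set.InjOn F ↑(lexRooted n) ∧ ∀ χ ∈ lexRooted n, F χ ∈ lexRooted n ∧ width n (F χ) = width n χ ∧ height n (F χ) = height n χ ∧ ymin n (F χ) + ymax n (F χ) = ymin n χ + ymax n χ ∧ tipRow n (F χ) = ymin n χ + ymax n χ - esRow n χ := by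
  intro n hn
  classical
  have hn2 : 2 ≤ n := le_trans (by norm_num) hn
  -- choose the reflected representative (with its anchor and flip) for every lex-rooted `χ`
  have key : ∀ χ : ℕ → Site 2, ∃ p : (ℕ → Site 2) × Site 2 × (Site 2 → Site 2), χ ∈ lexRooted n →
      p.1 ∈ lexRooted n ∧ p.2.1 ∈ verts n χ ∧ (∀ x ∈ verts n χ, x 1 ≤ p.2.1 1) ∧
        (∀ x, p.2.2 x 0 = x 0 - p.2.1 0 ∧ p.2.2 x 1 = p.2.1 1 - x 1) ∧
        pedges n p.1 = (pedges n χ).image (Sym2.map p.2.2) := by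
    intro χ
    by_cases hχ : χ ∈ lexRooted n
    · obtain ⟨χ', t, g, h1, h2, h3, h4, h5⟩ := exists_vrefl hn (lexRooted_subset n hχ)
      exact ⟨(χ', t, g), fun _ => ⟨h1, h2, h3, h4, h5⟩⟩
    · exact ⟨(χ, 0, id), fun h => (hχ h).elim⟩
  choose Φ hΦ using key
  have hz : ∀ {χ : ℕ → Site 2}, χ ∈ lexRooted n → (0 : Site 2) ∈ verts n χ := fun {χ} hχ => by
    have h := apply_mem_verts χ (Nat.zero_le n)
    rwa [(Zd.mem_sawFun.1 (lexRooted_subset n hχ)).1] at h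
  have hl : ∀ {χ : ℕ → Site 2}, χ ∈ lexRooted n → ∀ y ∈ verts n χ, LexPos y :=
      fun {χ} hχ y hy => by
    obtain ⟨m, hm, rfl⟩ := Finset.mem_image.1 hy
    exact (mem_lexRooted.1 hχ).2 m (Nat.lt_succ_iff.1 (Finset.mem_range.1 hm))
  refine ⟨fun χ => (Φ χ).1, ?_, ?_⟩
  · -- injectivity: the anchors agree, hence the flips, the polygons and the walks
    intro χ₁ h₁ χ₂ h₂ heq
    rw [Finset.mem_coe] at h₁ h₂
    obtain ⟨-, -, -, hg₁, hpe₁⟩ := hΦ χ₁ h₁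
    obtain ⟨-, -, -, hg₂, hpe₂⟩ := hΦ χ₂ h₂
    dsimp only at heq
    have hV : (verts n χ₁).image (Φ χ₁).2.2 = (verts n χ₂).image (Φ χ₂).2.2 := by
      rw [← verts_eq_of_pedges_eq_image hpe₁, ← verts_eq_of_pedges_eq_image hpe₂, heq]
    have ha := flip_root_le hg₁ hg₂ (hz h₁) (hl h₂) hV
    have hb := flip_root_le hg₂ hg₁ (hz h₂) (hl h₁) hV.symm
    have hgg : (Φ χ₁).2.2 = (Φ χ₂).2.2 := by
      funext x
      ext j
      fin_cases j
      · show (Φ χ₁).2.2 x 0 = (Φ χ₂).2.2 x 0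
        rw [(hg₁ x).1, (hg₂ x).1]
        omega
      · show (Φ χ₁).2.2 x 1 = (Φ χ₂).2.2 x 1
        rw [(hg₁ x).2, (hg₂ x).2]
        omega
    rw [heq, hgg] at hpe₁
    have hpe : pedges n χ₁ = pedges n χ₂ :=
      Finset.image_injective (Sym2.map.injective (injective_of_flipCoord hg₂))
        (hpe₁.symm.trans hpe₂)
    exact eq_of_pedges_shift_eq (lexRooted_subset n h₁) (lexRooted_subset n h₂) hn2 (v := 0)
      (by rw [shift_by_zero, shift_by_zero]; exact hpe)
  · -- the geometry of the reflected representative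
    intro χ hχ
    obtain ⟨hmem, ht, htop, hg, hpe⟩ := hΦ χ hχ
    have hV := verts_eq_of_pedges_eq_image hpe
    have hA : ∀ v ∈ verts n (Φ χ).1, ∃ x ∈ verts n χ, v = (Φ χ).2.2 x := fun v hv => by
      rw [hV] at hv
      obtain ⟨x, hx, rfl⟩ := Finset.mem_image.1 hv
      exact ⟨x, hx, rfl⟩
    have hB : ∀ x ∈ verts n χ, (Φ χ).2.2 x ∈ verts n (Φ χ).1 := fun x hx => by
      rw [hV]; exact Finset.mem_image_of_mem _ hx
    -- the anchor row is the top row, the root row is the bottom row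
    have hty : ymax n χ = (Φ χ).2.1 1 := ymax_eq_of_verts htop ⟨_, ht, rfl⟩
    have hy0 : ymin n χ = 0 := by
      refine ymin_eq_of_verts (fun v hv => ?_) ⟨0, hz hχ, rfl⟩
      obtain ⟨m, hm, rfl⟩ := Finset.mem_image.1 hv
      exact apply_one_nonneg_of_mem_lexRooted hχ (Nat.lt_succ_iff.1 (Finset.mem_range.1 hm))
    -- the corners of the image
    have hxM : xmax n (Φ χ).1 = xmax n χ - (Φ χ).2.1 0 := by
      refine xmax_eq_of_verts (fun v hv => ?_) ?_
      · obtain ⟨x, hx, rfl⟩ := hA v hv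
        rw [(hg x).1]
        linarith [(bounds_of_mem_verts hx).2.1]
      · obtain ⟨x, hx, hxM⟩ := (exists_verts_extremes n χ).1
        exact ⟨_, hB x hx, by rw [(hg x).1, hxM]⟩
    have hxm : xmin n (Φ χ).1 = xmin n χ - (Φ χ).2.1 0 := by
      refine xmin_eq_of_verts (fun v hv => ?_) ?_
      · obtain ⟨x, hx, rfl⟩ := hA v hv
        rw [(hg x).1]
        linarith [(bounds_of_mem_verts hx).1]
      · obtain ⟨x, hx, hxm⟩ := (exists_verts_extremes n χ).2.1
        exact ⟨_, hB x hx, by rw [(hg x).1, hxm]⟩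
    have hyM : ymax n (Φ χ).1 = (Φ χ).2.1 1 - ymin n χ := by
      refine ymax_eq_of_verts (fun v hv => ?_) ?_
      · obtain ⟨x, hx, rfl⟩ := hA v hv
        rw [(hg x).2]
        linarith [(bounds_of_mem_verts hx).2.2.1]
      · obtain ⟨x, hx, hxm⟩ := (exists_verts_extremes n χ).2.2.2
        exact ⟨_, hB x hx, by rw [(hg x).2, hxm]⟩
    have hym : ymin n (Φ χ).1 = (Φ χ).2.1 1 - ymax n χ := by
      refine ymin_eq_of_verts (fun v hv => ?_) ?_
      · obtain ⟨x, hx, rfl⟩ := hA v hv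
        rw [(hg x).2]
        linarith [(bounds_of_mem_verts hx).2.2.2]
      · obtain ⟨x, hx, hxM'⟩ := (exists_verts_extremes n χ).2.2.1
        exact ⟨_, hB x hx, by rw [(hg x).2, hxM']⟩
    -- the rightmost column goes to the rightmost column, its lowest row to the highest
    have htip : tipRow n (Φ χ).1 = (Φ χ).2.1 1 - esRow n χ := by
      refine tipRow_eq_of_rightCol (fun v hv => ?_) ?_
      · obtain ⟨hv1, hv2⟩ := mem_rightCol.1 hv
        obtain ⟨x, hx, rfl⟩ := hA v hv1
        rw [(hg x).1, hxM] at hv2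
        have hxr : x ∈ rightCol n χ := mem_rightCol.2 ⟨hx, by omega⟩
        rw [(hg x).2]
        linarith [esRow_le hxr]
      · obtain ⟨x, hxr, hxe⟩ := exists_eq_esRow n χ
        obtain ⟨hx, hx0⟩ := mem_rightCol.1 hxr
        exact ⟨_, mem_rightCol.2 ⟨hB x hx, by rw [(hg x).1, hxM, hx0]⟩, by rw [(hg x).2, hxe]⟩
    refine ⟨hmem, ?_, ?_, ?_, ?_⟩
    · rw [width, width, hxM, hxm]; ring
    · rw [height, height, hyM, hym]; ring
    · rw [hyM, hym, hty, hy0]; ring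
    · rw [htip, hty, hy0]; ring

end Summit.CriticalPhenomena.SAWScalingLimit.Theorems.CriticalBubbleBound.Join

end
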